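import Literature.NumberTheory.Automorphic.GLnAutomorphicUnfolding
import Mathlib.MeasureTheory.Measure.Haar.Unique
import HarnessLib

/-!
# The Haar measure of `H = A_G · GL_n(K)` is `da ⊗ (counting measure on GL_n(K))`

Topic `NumberTheory/Automorphic`; namespace `Literature.NumberTheory.Automorphic`. A brick of the
discharge of `GodementJacquet1972_gjZeta_meromorphic` (Godement–Jacquet, LNM 260 (1972), §12–§13:
the global zeta integral is unfolded over the automorphic quotient, where the fibre integrals over
`H = A_G · GL_n(K)` become `∑_{γ ∈ GL_n(K)} ∫_{A_G} … da`, the shape in which Poisson summation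
over `M_n(K)` and the Mellin variable `a ∈ A_G ≅ ℝ_{>0}` appear). The tree's unfolding
(`GLnAutomorphicUnfolding`, `AutomorphicQuotientKernel`) is written for the Haar measure `ρ_H` of
the closed subgroup `H` (`quotientSubgroupHaar`) and deliberately left the product structure of
`ρ_H` to a later file (module docstring of `GLnAutomorphicUnfolding`, design notes). This file
supplies it:

* `centralRetraction n K : GL_n(𝔸_K) →* GL_n(𝔸_K)` — a choice of the continuous retraction
  `θ(g) = z(|det g|_𝔸^{1/(n[K:ℚ])})` onto `A_G`, trivial on `GL_n(K)`
  (`exists_centralRetraction_gl` of `AdelicGroupDataGLnProofs`, made a definition), with its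
  properties, and `isClosed_center'_gl` (`A_G` is closed);
* `quotientSubgroupEquiv n K : H ≃ₜ* A_G × GL_n(K)`, `h ↦ (θ h, θ(h)⁻¹ h)` with inverse
  `(a, γ) ↦ a γ` — **`H` is the topological direct product of the closed central subgroup `A_G`
  and the discrete subgroup `GL_n(K)`** (Weil's splitting composed with `det`; Borel (1963), §5);
* `isHaarMeasure_count_of_discrete` — counting measure is a Haar measure on a countable discrete
  group (here `GL_n(K)`);
* `exists_lintegral_quotientSubgroup_eq_mul_tsum_lintegral` — **for every Haar measure `ρ` on `H`
  and every Haar measure `α` on `A_G` there is `κ > 0` with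
  `∫_H F dρ = κ ∑_{γ ∈ GL_n(K)} ∫_{A_G} F(a γ) dα(a)` for all measurable `F ≥ 0`** (uniqueness of
  Haar measure on `A_G × GL_n(K)`, Mathlib `isMulLeftInvariant_eq_smul`, transported along
  `quotientSubgroupEquiv`; Tonelli).

Everything here is proved; two definitions with bodies (`centralRetraction`,
`quotientSubgroupEquiv`).

## References

* A. Weil, *Basic Number Theory* (1967), Ch. IV §4, Thm. 5 and Cor. 2 (`k_𝔸ˣ = k_𝔸¹ × M`)
  [WeilBNT1967].
* A. Borel, *Some finiteness properties of adele groups over number fields*, Publ. Math. IHÉS 16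
  (1963), §5 [Borel1963].
* R. Godement, H. Jacquet, *Zeta functions of simple algebras*, LNM 260 (1972), §12
  [GodementJacquet1972].
-/

noncomputable section

open MeasureTheory Measure Set Filter Topology IsDedekindDomain NumberField
open scoped ENNReal NNReal

namespace Literature.NumberTheory.Automorphic

variable (n : ℕ) (K : Type) [Field K] [NumberField K]

attribute [local instance] adelicBorel borelSpace_adelic locallyCompactSpace_adelic
  secondCountableTopology_gl_adelic

/-! ### The central retraction `θ` -/

/-- **The central retraction `θ : GL_n(𝔸_K) →* A_G ≤ GL_n(𝔸_K)`**, `θ(g) = z(|det g|_𝔸^{1/(n[K:ℚ])})`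
(a choice of the homomorphism of `exists_centralRetraction_gl`: continuous, valued in `A_G`, the
identity on `A_G`, trivial on `GL_n(K)`; Weil's splitting `k_𝔸ˣ = k_𝔸¹ × M` composed with `det`).
[cite: WeilBNT1967, Ch. IV §4 Cor. 2 of Thm. 5] -/
def centralRetraction : (AdelicGroupData.gl n K).Adelic →* (AdelicGroupData.gl n K).Adelic :=
  (exists_centralRetraction_gl n K).choose

/-- `θ` is continuous. [folklore] -/
theorem continuous_centralRetraction : Continuous (centralRetraction n K) :=
  (exists_centralRetraction_gl n K).choose_spec.1

/-- `θ` takes values in `A_G`. [folklore] -/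
theorem centralRetraction_mem (g : (AdelicGroupData.gl n K).Adelic) :
    centralRetraction n K g ∈ (AdelicGroupData.gl n K).center' :=
  (exists_centralRetraction_gl n K).choose_spec.2.1 g

/-- `θ` is the identity on `A_G`. [folklore] -/
theorem centralRetraction_eq_self {a : (AdelicGroupData.gl n K).Adelic}
    (ha : a ∈ (AdelicGroupData.gl n K).center') : centralRetraction n K a = a :=
  (exists_centralRetraction_gl n K).choose_spec.2.2.1 a ha

/-- `θ` is trivial on `GL_n(K)`. [folklore] -/
theorem centralRetraction_eq_one {γ : (AdelicGroupData.gl n K).Adelic}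
    (hγ : γ ∈ (AdelicGroupData.gl n K).arithmeticSubgroup) : centralRetraction n K γ = 1 :=
  (exists_centralRetraction_gl n K).choose_spec.2.2.2 γ hγ

/-- The values of `θ` are central. [folklore] -/
theorem centralRetraction_mem_center (g : (AdelicGroupData.gl n K).Adelic) :
    centralRetraction n K g ∈ Subgroup.center (AdelicGroupData.gl n K).Adelic :=
  (AdelicGroupData.gl n K).center'_le (centralRetraction_mem n K g)

/-- **`A_G` is closed in `GL_n(𝔸_K)`**: it is the fixed-point set `{g | θ g = g}` of the continuous
retraction. [folklore] -/
theorem isClosed_center'_gl :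
    IsClosed ((AdelicGroupData.gl n K).center' : Set (AdelicGroupData.gl n K).Adelic) := by
  haveI : T2Space (AdelicGroupData.gl n K).Adelic := t2Space_gl n K
  have h : ((AdelicGroupData.gl n K).center' : Set (AdelicGroupData.gl n K).Adelic) =
      {g | centralRetraction n K g = g} :=
    Set.ext fun g => ⟨fun hg => centralRetraction_eq_self n K hg,
      fun hg => hg ▸ centralRetraction_mem n K g⟩
  rw [h]
  exact isClosed_eq (continuous_centralRetraction n K) continuous_id

/-- For `h ∈ H = A_G · GL_n(K)` the element `θ(h)⁻¹ h` is rational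
(`quotientSubgroup_gl_eq_preimage`). [folklore] -/
theorem inv_centralRetraction_mul_mem {h : (AdelicGroupData.gl n K).Adelic}
    (hh : h ∈ (AdelicGroupData.gl n K).quotientSubgroup) :
    (centralRetraction n K h)⁻¹ * h ∈ (AdelicGroupData.gl n K).arithmeticSubgroup := by
  have hset := quotientSubgroup_gl_eq_preimage n K (centralRetraction_mem n K)
    (fun a ha => centralRetraction_eq_self n K ha) (fun γ hγ => centralRetraction_eq_one n K hγ)
  have : h ∈ ((AdelicGroupData.gl n K).quotientSubgroup : Set (AdelicGroupData.gl n K).Adelic) := hh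
  rw [hset] at this
  exact this

/-! ### `H ≅ A_G × GL_n(K)` as topological groups -/

/-- **`H = A_G · GL_n(K)` is the topological direct product `A_G × GL_n(K)`**:
`h ↦ (θ h, θ(h)⁻¹ h)` with inverse `(a, γ) ↦ a γ` (a continuous isomorphism of topological groups,
`A_G` being central, `A_G ∩ GL_n(K) = 1` and `θ` continuous). Borel (1963), §5; Weil, BNT IV §4.
[cite: Borel1963, §5] -/
def quotientSubgroupEquiv :
    (AdelicGroupData.gl n K).quotientSubgroup ≃ₜ*
      (AdelicGroupData.gl n K).center' × (AdelicGroupData.gl n K).arithmeticSubgroup where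
  toFun h := (⟨centralRetraction n K h, centralRetraction_mem n K h⟩,
    ⟨(centralRetraction n K h)⁻¹ * h, inv_centralRetraction_mul_mem n K h.2⟩)
  invFun p := ⟨(p.1 : (AdelicGroupData.gl n K).Adelic) * p.2,
    mul_mem ((AdelicGroupData.gl n K).center'_le_quotientSubgroup p.1.2)
      ((AdelicGroupData.gl n K).arithmeticSubgroup_le_quotientSubgroup p.2.2)⟩
  left_inv h := Subtype.ext (mul_inv_cancel_left _ _)
  right_inv p := by
    obtain ⟨⟨a, ha⟩, ⟨γ, hγ⟩⟩ := p
    have hθ : centralRetraction n K (a * γ) = a := by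
      rw [map_mul, centralRetraction_eq_self n K ha, centralRetraction_eq_one n K hγ, mul_one]
    refine Prod.ext (Subtype.ext hθ) (Subtype.ext ?_)
    change (centralRetraction n K (a * γ))⁻¹ * (a * γ) = γ
    rw [hθ, inv_mul_cancel_left]
  map_mul' h h' := by
    refine Prod.ext (Subtype.ext (map_mul _ _ _)) (Subtype.ext ?_)
    change (centralRetraction n K ((h : (AdelicGroupData.gl n K).Adelic) * h'))⁻¹ *
        ((h : (AdelicGroupData.gl n K).Adelic) * h') =
      (centralRetraction n K h)⁻¹ * h * ((centralRetraction n K h')⁻¹ * h')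
    rw [map_mul, mul_inv_rev]
    have hc : (centralRetraction n K (h' : (AdelicGroupData.gl n K).Adelic))⁻¹ ∈
        Subgroup.center (AdelicGroupData.gl n K).Adelic :=
      Subgroup.inv_mem _ (centralRetraction_mem_center n K _)
    have hB : ∀ g : (AdelicGroupData.gl n K).Adelic,
        g * (centralRetraction n K (h' : (AdelicGroupData.gl n K).Adelic))⁻¹ =
          (centralRetraction n K (h' : (AdelicGroupData.gl n K).Adelic))⁻¹ * g :=
      fun g => Subgroup.mem_center_iff.1 hc g
    set A := (centralRetraction n K (h : (AdelicGroupData.gl n K).Adelic))⁻¹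
    set B := (centralRetraction n K (h' : (AdelicGroupData.gl n K).Adelic))⁻¹
    -- `θ'⁻¹ θ⁻¹ h h' = θ⁻¹ h θ'⁻¹ h'`
    calc B * A * ((h : (AdelicGroupData.gl n K).Adelic) * h')
        = A * B * ((h : (AdelicGroupData.gl n K).Adelic) * h') := by rw [hB A]
      _ = A * (B * (h : (AdelicGroupData.gl n K).Adelic)) * h' := by simp only [mul_assoc]
      _ = A * ((h : (AdelicGroupData.gl n K).Adelic) * B) * h' := by rw [hB]
      _ = A * h * (B * h') := by simp only [mul_assoc]
  continuous_toFun := by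
    refine Continuous.prodMk ?_ ?_
    · exact ((continuous_centralRetraction n K).comp continuous_subtype_val).subtype_mk _
    · exact (((continuous_centralRetraction n K).comp continuous_subtype_val).inv.mul
        continuous_subtype_val).subtype_mk _
  continuous_invFun :=
    ((continuous_subtype_val.comp continuous_fst).mul
      (continuous_subtype_val.comp continuous_snd)).subtype_mk _

variable {n K} in
/-- The inverse of `quotientSubgroupEquiv` is multiplication: `(a, γ) ↦ a γ`. [folklore] -/
@[simp]
theorem coe_quotientSubgroupEquiv_symm_apply
    (p : (AdelicGroupData.gl n K).center' × (AdelicGroupData.gl n K).arithmeticSubgroup) :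
    (((quotientSubgroupEquiv n K).symm p : (AdelicGroupData.gl n K).quotientSubgroup) :
      (AdelicGroupData.gl n K).Adelic) = (p.1 : (AdelicGroupData.gl n K).Adelic) * p.2 := rfl

/-! ### Topology and counting measure on `GL_n(K)`, local compactness of `A_G` -/

/-- `GL_n(K)` is discrete in `GL_n(𝔸_K)` (`gl_isDiscreteRational_holds`), as an instance. [folklore] -/
instance instDiscreteTopologyArithmeticSubgroup :
    DiscreteTopology (AdelicGroupData.gl n K).arithmeticSubgroup :=
  gl_isDiscreteRational_holds n K

/-- `GL_n(K)` is countable (the image of the countable group `GL (Fin n) K`). [folklore] -/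
instance instCountableArithmeticSubgroup : Countable (AdelicGroupData.gl n K).arithmeticSubgroup := by
  haveI : Countable K := NumberField.countable' (K := K)
  haveI : Countable (Matrix (Fin n) (Fin n) K) := inferInstanceAs (Countable (Fin n → Fin n → K))
  haveI : Countable (AdelicGroupData.gl n K).Rational :=
    (Units.val_injective : Function.Injective (Units.val : GL (Fin n) K → Matrix (Fin n) (Fin n) K)).countable
  change Countable (Set.range (AdelicGroupData.gl n K).toAdelic)
  exact (Set.countable_range _).to_subtype

/-- `A_G` is locally compact (a closed subgroup of `GL_n(𝔸_K)`). [folklore] -/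
instance instLocallyCompactSpaceCenter' : LocallyCompactSpace (AdelicGroupData.gl n K).center' :=
  (isClosed_center'_gl n K).isClosedEmbedding_subtypeVal.locallyCompactSpace

/-- `A_G` is second countable. [folklore] -/
instance instSecondCountableCenter' : SecondCountableTopology (AdelicGroupData.gl n K).center' :=
  TopologicalSpace.Subtype.secondCountableTopology _

/-- `GL_n(K)` is second countable. [folklore] -/
instance instSecondCountableArithmeticSubgroup :
    SecondCountableTopology (AdelicGroupData.gl n K).arithmeticSubgroup :=
  TopologicalSpace.Subtype.secondCountableTopology _

/-- **Counting measure is a Haar measure on a countable discrete group** (compact sets are finite).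
[folklore] -/
theorem isHaarMeasure_count_of_discrete {Γ : Type*} [Group Γ] [TopologicalSpace Γ] [DiscreteTopology Γ]
    [Countable Γ] [MeasurableSpace Γ] [MeasurableSingletonClass Γ] : (count : Measure Γ).IsHaarMeasure := by
  haveI : MeasurableMul Γ := ⟨fun _ => measurable_of_countable _, fun _ => measurable_of_countable _⟩
  exact
    { lt_top_of_isCompact := fun _ hC => count_apply_lt_top.2 hC.finite_of_discrete
      open_pos := fun _ _ hU => count_ne_zero_iff.2 hU
      map_mul_left_eq_self := fun g => map_mul_left_eq_self count g }

/-! ### `ρ_H = κ · (dα ⊗ counting)` -/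

variable {n K}

/-- **Every Haar measure on `H = A_G · GL_n(K)` is a multiple of `dα ⊗ (counting measure)`**
(transported along `quotientSubgroupEquiv`): for Haar measures `ρ` on `H` and `α` on `A_G` there is
`κ > 0` with `∫_H F dρ = κ ∫_{A_G} ∑_{γ ∈ GL_n(K)} F(a γ) dα(a)` for every measurable `F ≥ 0` on `H`
(Haar uniqueness on the second countable locally compact group `A_G × GL_n(K)`, Mathlib
`isMulLeftInvariant_eq_smul`; Tonelli for the counting measure). This is the form of the fibre
integrals `∫_H f(g h) dρ_H(h) = κ ∑_γ ∫_{A_G} f(g a γ) da` of the unfolding of the global zeta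
integral (Godement–Jacquet (1972), §12). [cite: GodementJacquet1972, §12 (proof of Thm. 13.8)] -/
theorem exists_lintegral_quotientSubgroup_eq_mul_lintegral_tsum
    (ρ : Measure (AdelicGroupData.gl n K).quotientSubgroup) [ρ.IsHaarMeasure]
    (α : Measure (AdelicGroupData.gl n K).center') [α.IsHaarMeasure] :
    ∃ κ : ℝ≥0, 0 < κ ∧ ∀ F : (AdelicGroupData.gl n K).quotientSubgroup → ℝ≥0∞, Measurable F →
      ∫⁻ h, F h ∂ρ = κ * ∫⁻ a, ∑' γ : (AdelicGroupData.gl n K).arithmeticSubgroup,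
        F ((quotientSubgroupEquiv n K).symm (a, γ)) ∂α := by
  haveI : BorelSpace (AdelicGroupData.gl n K).arithmeticSubgroup := Subtype.borelSpace _
  haveI : MeasurableSingletonClass (AdelicGroupData.gl n K).arithmeticSubgroup := inferInstance
  haveI : (count : Measure (AdelicGroupData.gl n K).arithmeticSubgroup).IsHaarMeasure :=
    isHaarMeasure_count_of_discrete
  haveI : BorelSpace ((AdelicGroupData.gl n K).center' × (AdelicGroupData.gl n K).arithmeticSubgroup) :=
    Prod.borelSpace
  set e := quotientSubgroupEquiv n K with he
  set π : Measure ((AdelicGroupData.gl n K).center' × (AdelicGroupData.gl n K).arithmeticSubgroup) :=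
    α.prod count with hπ
  haveI : π.IsHaarMeasure := by rw [hπ]; infer_instance
  set ρ' := Measure.map e ρ with hρ'
  haveI : ρ'.IsHaarMeasure := e.toMulEquiv.isHaarMeasure_map ρ e.continuous e.symm.continuous
  set κ : ℝ≥0 := ρ'.haarScalarFactor π with hκ
  have hρ'π : ρ' = κ • π := isMulLeftInvariant_eq_smul ρ' π
  refine ⟨κ, haarScalarFactor_pos_of_isHaarMeasure ρ' π, fun F hF => ?_⟩
  set em : (AdelicGroupData.gl n K).quotientSubgroup ≃ᵐ
      (AdelicGroupData.gl n K).center' × (AdelicGroupData.gl n K).arithmeticSubgroup :=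
    e.toHomeomorph.toMeasurableEquiv with hem
  have hem' : (em : _ → _) = e := rfl
  have hG : Measurable fun p : (AdelicGroupData.gl n K).center' × (AdelicGroupData.gl n K).arithmeticSubgroup =>
      F (e.symm p) := hF.comp e.symm.continuous.measurable
  -- transport to `A_G × GL_n(K)`
  have h1 : ∫⁻ p, F (e.symm p) ∂ρ' = ∫⁻ h, F h ∂ρ := by
    rw [hρ', ← hem', lintegral_map_equiv]
    refine lintegral_congr fun h => ?_
    rw [hem', ContinuousMulEquiv.symm_apply_apply]
  rw [← h1, hρ'π, lintegral_smul_measure, hπ, lintegral_prod _ hG.aemeasurable]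
  congr 1
  refine lintegral_congr fun a => ?_
  rw [lintegral_count]

end Literature.NumberTheory.Automorphic
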